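import Summits.CriticalPhenomena.PercolationContinuityZ3.Theorems.PercNearOneGluingNoHeavyLowerTailSunflowerOpenProductElim

/-!
# `NoHeavyLowerTail` (crux stmt-CriticalPhenomena-4575), abstract sunflower cubic: THE OPEN PRODUCT OF A UNION-CLOSED FAMILY
# Part C — (PAR): `1 - ∏_{S ∈ 𝒪} t_S` HAS NONNEGATIVE COEFFICIENTS FOR EVERY UNION-CLOSED `𝒪`

Support file (seat `prim-ineq-prove-1` gen 46; `--supports stmt-CriticalPhenomena-4575`).  Continues `…SunflowerOpenProductElim`.
Memo: run/shared/lean/prim/prim-ineq-prove-1/FINDING-PAR-prove1-g46.md §1 (Theorem 1).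
PROOF.  FACT 4 (`cong1_T_of_nonOpen`, uses union-closure once: a non-open `S` has an element lying in no open subset of
`S`): if every non-open colour vanishes below degree `d`, every non-open Möbius factor is `≡ 1` below `d`, hence
(`coeff_one_sub_F_of_nonOpen`, with FACT 1) the coefficients of `1 - F_𝒪` below `d` are those of `y m univ ≥ 0`.
FACT 3 / the induction (`coeff_one_sub_F_nonneg_aux`): descending induction on `d`, inner induction on the number of
non-open colours with a nonzero degree-`d` coefficient; each elimination of such a colour (FACT 2, `F_elim`) keeps `F_𝒪`
and kills that colour in degree `d` (`bad_elim_subset`).  Starting configuration `m0` (one letter `a` of colour `{a}`).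
* **`coeff_one_sub_prod_tS_nonneg`** — (PAR) in explicit form: `0 ≤ coeff n (1 - ∏_{S ∈ 𝒪} tS S)` for union-closed `𝒪`, with
  `tS S = (∏_{B ⊆ S, #(S∖B) even} (1 - ∑_{a∈B} X a)) · (∏_{B ⊆ S, #(S∖B) odd} (1 - ∑_{a∈B} X a))⁻¹`.
Equivalent forms (memo, exponential formula): among the all-cycles-open permutations of any word, #odd ≥ #even; `1/∏ t_S`
is the generating function of a free monoid.  Consequence chain (memo §2–§3, paper): Möbius certificate ⇒ BAL-bip.
-/

namespace Summit.CriticalPhenomena.PercolationContinuityZ3.Theorems.SunflowerPartition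

namespace OpenProduct

open MvPowerSeries Finset

variable {A : Type*} [DecidableEq A]

/-! ## FACT 4: in an "all-open" configuration every non-open Möbius factor is `≡ 1` -/

variable {m : Finset A → MvPowerSeries A ℚ}

/-- Union-closure: a nonempty set outside `𝒪` has an element lying in no member of `𝒪` inside it. [this work] -/
theorem exists_mem_not_mem_of_not_mem (𝒪 : Finset (Finset A)) (h𝒪 : ∀ S ∈ 𝒪, ∀ S' ∈ 𝒪, S ∪ S' ∈ 𝒪)
    (S : Finset A) (hS : S.Nonempty) (hS𝒪 : S ∉ 𝒪) : ∃ s ∈ S, ∀ O ∈ 𝒪, O ⊆ S → s ∉ O := by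
  by_contra hcon
  push Not at hcon
  choose O hO𝒪 hOS hsO using hcon
  -- `S` is the union of the `O s`, hence open
  have hsup : S.attach.sup (fun s => O s.1 s.2) = S := by
    apply Subset.antisymm
    · exact Finset.sup_le fun s _ => hOS s.1 s.2
    · intro s hs
      exact Finset.mem_sup.mpr ⟨⟨s, hs⟩, mem_attach _ _, hsO s hs⟩
  have hmem : S.attach.sup (fun s => O s.1 s.2) ∈ 𝒪 := by
    obtain ⟨s₀, hs₀⟩ := hS
    have hne : S.attach.Nonempty := ⟨⟨s₀, hs₀⟩, mem_attach _ _⟩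
    rw [← Finset.sup'_eq_sup hne]
    refine Finset.sup'_induction hne _ (fun a ha b hb => ?_) (fun s _ => hO𝒪 s.1 s.2)
    exact h𝒪 a ha b hb
  exact hS𝒪 (hsup ▸ hmem)

/-- If all non-open colours inside `S ∋ s`-type sets vanish below `N+1`, then `y (insert s B) ≡ y B`. [this work] -/
theorem vanLT_y_insert_sub (d : ℕ) (s : A) (B : Finset A) (hs : s ∉ B)
    (h : ∀ C ⊆ B, VanLT d (m (insert s C))) : VanLT d (y m (insert s B) - y m B) := by
  have : y m (insert s B) - y m B = ∑ C ∈ B.powerset, m (insert s C) := by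
    rw [y, y, sum_powerset_insert hs]; ring
  rw [this]
  exact VanLT.sum _ _ fun C hC => h C (mem_powerset.mp hC)

/-- `U_B⁻¹ · U_{B ∪ s} ≡ 1` below `d` when the colours `C ∪ s`, `C ⊆ B`, vanish below `d`. [this work] -/
theorem cong1_U_inv_mul_U (hm : IsConfig m) (d : ℕ) (s : A) (B : Finset A) (hs : s ∉ B)
    (h : ∀ C ⊆ B, VanLT d (m (insert s C))) : Cong1 d ((U m hm B)⁻¹ * U m hm (insert s B)) := by
  unfold Cong1
  have : (((U m hm B)⁻¹ * U m hm (insert s B) : (MvPowerSeries A ℚ)ˣ) : MvPowerSeries A ℚ) - 1 =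
      (((U m hm B)⁻¹ : (MvPowerSeries A ℚ)ˣ) : MvPowerSeries A ℚ) * -(y m (insert s B) - y m B) := by
    have hinv : (((U m hm B)⁻¹ : (MvPowerSeries A ℚ)ˣ) : MvPowerSeries A ℚ) * (1 - y m B) = 1 := by
      rw [← val_U hm B, Units.inv_mul]
    rw [Units.val_mul, val_U]
    linear_combination hinv
  rw [this]
  exact ((vanLT_y_insert_sub d s B hs h).neg).mul_left _

/-- `sgn (insert s B) (insert s S₀) = - sgn B (insert s S₀)` for `s ∉ S₀ ⊇ B`. [this work] -/
theorem sgn_insert_insert (s : A) (B S₀ : Finset A) (hs : s ∉ S₀) (hB : B ⊆ S₀) :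
    sgn (insert s B) (insert s S₀) = -sgn B (insert s S₀) := by
  unfold sgn
  have h1 : insert s S₀ \ insert s B = S₀ \ B := by
    ext a
    simp only [mem_sdiff, mem_insert]
    constructor
    · rintro ⟨ha | ha, hne⟩
      · exact absurd (Or.inl ha) hne
      · exact ⟨ha, fun hb => hne (Or.inr hb)⟩
    · rintro ⟨ha, hb⟩
      exact ⟨Or.inr ha, fun h => h.elim (fun h => hs (h ▸ ha)) hb⟩
  have h2 : insert s S₀ \ B = insert s (S₀ \ B) := by
    ext a
    simp only [mem_sdiff, mem_insert]
    constructor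
    · rintro ⟨ha | ha, hb⟩
      · exact Or.inl ha
      · exact Or.inr ⟨ha, hb⟩
    · rintro (ha | ⟨ha, hb⟩)
      · exact ⟨Or.inl ha, fun hb => hs (ha ▸ hB hb)⟩
      · exact ⟨Or.inr ha, hb⟩
  have hs' : s ∉ S₀ \ B := fun h => hs (mem_sdiff.mp h).1
  rw [h1, h2, card_insert_of_notMem hs', pow_succ]
  ring

/-- FACT 4 (one factor): `T m S ≡ 1` below degree `d` when every colour `C ⊆ S` containing the
distinguished element `s` vanishes below `d`. [this work] -/
theorem cong1_T_insert (hm : IsConfig m) (d : ℕ) (s : A) (S₀ : Finset A) (hs : s ∉ S₀)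
    (h : ∀ C ⊆ S₀, VanLT d (m (insert s C))) : Cong1 d (T m hm (insert s S₀)) := by
  unfold T
  rw [prod_powerset_insert hs, ← prod_mul_distrib]
  refine Cong1.prod _ _ fun B hB => ?_
  have hB' : B ⊆ S₀ := mem_powerset.mp hB
  have hsB : s ∉ B := fun hsB => hs (hB' hsB)
  have key := cong1_U_inv_mul_U hm d s B hsB (fun C hC => h C (hC.trans hB'))
  rw [sgn_insert_insert s B S₀ hs hB']
  have : U m hm B ^ sgn B (insert s S₀) * U m hm (insert s B) ^ (-sgn B (insert s S₀)) =
      (((U m hm B)⁻¹ * U m hm (insert s B))⁻¹) ^ sgn B (insert s S₀) := by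
    rw [mul_inv_rev, inv_inv, mul_zpow, inv_zpow']
    exact mul_comm _ _
  rw [this]
  exact (key.inv).zpow _

/-- The family of NON-open nonempty colour sets. [this work] -/
def nonOpen [Fintype A] (𝒪 : Finset (Finset A)) : Finset (Finset A) := ((univ : Finset A).powerset \ 𝒪).erase ∅

/-- Membership in `nonOpen 𝒪`: nonempty and not in `𝒪`. [this work] -/
theorem mem_nonOpen [Fintype A] {𝒪 : Finset (Finset A)} {S : Finset A} : S ∈ nonOpen 𝒪 ↔ S.Nonempty ∧ S ∉ 𝒪 := by
  simp [nonOpen, nonempty_iff_ne_empty]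

/-- FACT 4: if every non-open colour vanishes below `d`, then every non-open Möbius factor is `≡ 1` below `d`
(uses union-closure of `𝒪`). [this work] -/
theorem cong1_T_of_nonOpen [Fintype A] (hm : IsConfig m) (𝒪 : Finset (Finset A))
    (h𝒪 : ∀ S ∈ 𝒪, ∀ S' ∈ 𝒪, S ∪ S' ∈ 𝒪) (d : ℕ) (hvan : ∀ C ∈ nonOpen 𝒪, VanLT d (m C))
    (S : Finset A) (hS : S ∈ nonOpen 𝒪) : Cong1 d (T m hm S) := by
  obtain ⟨hSne, hS𝒪⟩ := mem_nonOpen.mp hS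
  obtain ⟨s, hsS, hs⟩ := exists_mem_not_mem_of_not_mem 𝒪 h𝒪 S hSne hS𝒪
  rw [← insert_erase hsS]
  refine cong1_T_insert hm d s (S.erase s) (notMem_erase s S) fun C hC => hvan _ (mem_nonOpen.mpr ⟨?_, ?_⟩)
  · exact insert_nonempty s C
  · intro hC𝒪
    refine hs _ hC𝒪 ?_ (mem_insert_self s C)
    rw [← insert_erase hsS]
    exact insert_subset_insert s hC

/-- FACT 1 split along `𝒪` and its complement: `F_𝒪 · F_𝒬 = U_A`. [this work] -/
theorem F_mul_F_nonOpen [Fintype A] (hm : IsConfig m) (𝒪 : Finset (Finset A)) :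
    F m hm 𝒪 * F m hm (nonOpen 𝒪) = U m hm univ := by
  rw [← prod_T_powerset_univ hm, F, F, nonOpen]
  have hT0 : T m hm ∅ = 1 := by simp [T, sgn, U_empty hm]
  rw [prod_erase _ hT0]
  have hsub : 𝒪 ⊆ (univ : Finset A).powerset := fun S _ => mem_powerset.mpr (subset_univ S)
  rw [← prod_sdiff hsub, mul_comm]

/-- In an all-open configuration the open product is `≡ 1 - y_A`: the coefficients of `1 - F_𝒪` in degrees `< d`
are those of `y m univ`. [this work] -/
theorem coeff_one_sub_F_of_nonOpen [Fintype A] (hm : IsConfig m) (𝒪 : Finset (Finset A))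
    (h𝒪 : ∀ S ∈ 𝒪, ∀ S' ∈ 𝒪, S ∪ S' ∈ 𝒪) (d : ℕ)
    (hvan : ∀ C ∈ nonOpen 𝒪, VanLT d (m C)) (n : A →₀ ℕ) (hn : n.degree < d) :
    coeff n (1 - (F m hm 𝒪 : MvPowerSeries A ℚ)) = coeff n (y m univ) := by
  have hQ : Cong1 d (F m hm (nonOpen 𝒪))⁻¹ :=
    (Cong1.prod _ _ fun S hS => cong1_T_of_nonOpen hm 𝒪 h𝒪 d hvan S hS).inv
  have hF : F m hm 𝒪 = U m hm univ * (F m hm (nonOpen 𝒪))⁻¹ := by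
    rw [← F_mul_F_nonOpen hm 𝒪, mul_inv_cancel_right]
  have hdiff : VanLT d ((1 - (F m hm 𝒪 : MvPowerSeries A ℚ)) - y m univ) := by
    have : (1 - (F m hm 𝒪 : MvPowerSeries A ℚ)) - y m univ =
        -((1 - y m univ) * ((((F m hm (nonOpen 𝒪))⁻¹ : (MvPowerSeries A ℚ)ˣ) : MvPowerSeries A ℚ) - 1)) := by
      rw [hF, Units.val_mul, val_U]; ring
    rw [this]
    exact (hQ.mul_left _).neg
  have := hdiff n hn
  rw [map_sub, sub_eq_zero] at this
  exact this

/-! ## The induction (FACT 3: progress of the elimination) -/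

open Classical in
/-- The non-open colours with a nonzero coefficient in degree exactly `d`. [this work] -/
noncomputable def bad [Fintype A] (𝒪 : Finset (Finset A)) (m : Finset A → MvPowerSeries A ℚ) (d : ℕ) :
    Finset (Finset A) :=
  (nonOpen 𝒪).filter fun C => ¬ ∀ n : A →₀ ℕ, n.degree = d → coeff n (m C) = 0

omit [DecidableEq A] in
/-- `g m C = m C · (1 - m C)⁻¹`. [this work] -/
theorem g_eq_mul (hm : IsConfig m) (C : Finset A) : g m C = m C * (1 - m C)⁻¹ := by
  have h := one_sub_mul_inv hm C
  rw [g]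
  linear_combination h

/-- `g m C` vanishes below `d` if `m C` does. [this work] -/
theorem vanLT_g (hm : IsConfig m) {d : ℕ} {C : Finset A} (hC : VanLT d (m C)) : VanLT d (g m C) := by
  rw [g_eq_mul hm C]; exact hC.mul_right _

/-- The elimination preserves vanishing below `d` of ALL colours (given it for the eliminated colour). [this work] -/
theorem vanLT_elim (hm : IsConfig m) {d : ℕ} {C : Finset A} (hC : VanLT d (m C)) (S : Finset A)
    (hS : S ≠ C → VanLT d (m S)) : VanLT d (elim m C S) := by
  unfold elim
  refine VanLT.add ?_ ((vanLT_g hm hC).mul_right _)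
  split_ifs with h
  · exact VanLT.zero d
  · exact hS h

/-- The correction term `g · (…)` of the elimination vanishes below `d + 1`. [this work] -/
theorem vanLT_succ_g_mul (hm : IsConfig m) {d : ℕ} {C : Finset A} (hC : VanLT d (m C)) (S : Finset A) :
    VanLT (d + 1) (g m C * ∑ T ∈ S.powerset with (T ≠ C ∧ T ∪ C = S), m T) :=
  (vanLT_g hm hC).mul_of_constantCoeff (by rw [map_sum]; exact sum_eq_zero fun T _ => hm.const T)

/-- FACT 3: eliminating `C` kills `C` in degree `d` and changes no other colour in degree `≤ d`. [this work] -/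
theorem bad_elim_subset [Fintype A] (𝒪 : Finset (Finset A)) (hm : IsConfig m) {d : ℕ} {C : Finset A}
    (hC : VanLT d (m C)) : bad 𝒪 (elim m C) d ⊆ (bad 𝒪 m d).erase C := by
  classical
  intro S hS
  simp only [bad, mem_filter] at hS
  obtain ⟨hSQ, hSbad⟩ := hS
  have hcorr := vanLT_succ_g_mul hm hC S
  rw [mem_erase]
  refine ⟨?_, ?_⟩
  · rintro rfl
    apply hSbad
    intro n hn
    show coeff n ((if S = S then 0 else m S) + g m S * _) = 0
    rw [if_pos rfl, zero_add]
    exact hcorr n (by omega)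
  · simp only [bad, mem_filter]
    refine ⟨hSQ, fun hgood => hSbad fun n hn => ?_⟩
    show coeff n ((if S = C then 0 else m S) + g m C * _) = 0
    rw [map_add]
    split_ifs with hSC
    · rw [map_zero, zero_add]; exact hcorr n (by omega)
    · rw [hgood n hn, zero_add]; exact hcorr n (by omega)

/-- MAIN INDUCTION: for every configuration whose non-open colours vanish below `d`, all coefficients of
`1 - F_𝒪` of degree `≤ N` are nonnegative (descending induction on `d ≤ N + 1`, inner induction on `#bad`). [this work] -/
theorem coeff_one_sub_F_nonneg_aux [Fintype A] (𝒪 : Finset (Finset A)) (h𝒪 : ∀ S ∈ 𝒪, ∀ S' ∈ 𝒪, S ∪ S' ∈ 𝒪)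
    (N : ℕ) :
    ∀ k d : ℕ, d + k = N + 1 → ∀ (m : Finset A → MvPowerSeries A ℚ) (hm : IsConfig m),
      (∀ C ∈ nonOpen 𝒪, VanLT d (m C)) → ∀ n : A →₀ ℕ, n.degree ≤ N →
        0 ≤ coeff n (1 - (F m hm 𝒪 : MvPowerSeries A ℚ)) := by
  classical
  intro k
  induction k with
  | zero =>
    intro d hd m hm hvan n hn
    rw [coeff_one_sub_F_of_nonOpen hm 𝒪 h𝒪 d hvan n (by omega)]
    exact coeff_y_nonneg hm univ n
  | succ k ih =>
    intro d hd
    -- inner induction on the number of bad colours in degree `d`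
    suffices hc : ∀ c : ℕ, ∀ (m : Finset A → MvPowerSeries A ℚ) (hm : IsConfig m),
        (bad 𝒪 m d).card = c → (∀ C ∈ nonOpen 𝒪, VanLT d (m C)) → ∀ n : A →₀ ℕ, n.degree ≤ N →
          0 ≤ coeff n (1 - (F m hm 𝒪 : MvPowerSeries A ℚ)) from
      fun m hm hvan n hn => hc _ m hm rfl hvan n hn
    intro c
    induction c using Nat.strong_induction_on with
    | _ c ihc =>
      intro m hm hcard hvan n hn
      by_cases hbad : bad 𝒪 m d = ∅
      · -- no bad colour: everything non-open vanishes below `d + 1`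
        refine ih (d + 1) (by omega) m hm (fun C hC n' hn' => ?_) n hn
        rcases Nat.lt_succ_iff_lt_or_eq.mp hn' with hlt | heq
        · exact hvan C hC n' hlt
        · have : C ∉ bad 𝒪 m d := by rw [hbad]; exact notMem_empty C
          simp only [bad, mem_filter, not_and, not_not] at this
          exact this hC n' heq
      · obtain ⟨C, hCbad⟩ := nonempty_iff_ne_empty.mpr hbad
        have hCQ : C ∈ nonOpen 𝒪 := (mem_filter.mp hCbad).1
        have hC𝒪 : C ∉ 𝒪 := (mem_nonOpen.mp hCQ).2
        have hCvan : VanLT d (m C) := hvan C hCQ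
        -- eliminate `C`
        have hlt : (bad 𝒪 (elim m C) d).card < c := by
          calc (bad 𝒪 (elim m C) d).card ≤ ((bad 𝒪 m d).erase C).card :=
                card_le_card (bad_elim_subset 𝒪 hm hCvan)
            _ < (bad 𝒪 m d).card := card_erase_lt_of_mem hCbad
            _ = c := hcard
        have := ihc _ hlt (elim m C) (isConfig_elim hm C) rfl
          (fun S hS => vanLT_elim hm hCvan S fun _ => hvan S hS) n hn
        rwa [F_elim hm C 𝒪 hC𝒪] at this

/-! ## The initial configuration and the theorem -/

/-- The initial configuration: one letter `a` of colour `{a}` and degree `e_a`. [this work] -/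
noncomputable def m0 (A : Type*) [DecidableEq A] : Finset A → MvPowerSeries A ℚ :=
  fun C => if C.card = 1 then ∑ a ∈ C, X a else 0

/-- The initial configuration is a configuration. [this work] -/
theorem isConfig_m0 : IsConfig (m0 A) where
  empty := by simp [m0]
  const := fun C => by
    unfold m0
    split_ifs <;> simp [map_sum, constantCoeff_X]
  nonneg := fun C n => by
    unfold m0
    split_ifs
    · rw [map_sum]
      refine sum_nonneg fun a _ => ?_
      rw [coeff_X]
      split_ifs <;> norm_num
    · simp

/-- For the initial configuration `y B = ∑_{a ∈ B} X a`. [this work] -/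
theorem y_m0 (B : Finset A) : y (m0 A) B = ∑ a ∈ B, X a := by
  unfold y m0
  rw [← sum_filter, ← Finset.powersetCard_eq_filter, powersetCard_one, sum_map]
  refine sum_congr rfl fun a _ => ?_
  simp

omit [DecidableEq A] in
/-- Every colour of a configuration vanishes below degree `1` (no constant terms). [this work] -/
theorem vanLT_one_of_isConfig (hm : IsConfig m) (C : Finset A) : VanLT 1 (m C) := by
  intro n hn
  have : n = 0 := by
    have h0 : n.degree = 0 := by omega
    exact (Finsupp.degree_eq_zero_iff n).mp h0
  rw [this, coeff_zero_eq_constantCoeff_apply, hm.const]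

/-- **(PAR), general configuration form** (memo §1.4 (c)): for a union-closed `𝒪` and ANY configuration `m` (letters with
arbitrary colour sets and multidegrees), every coefficient of `1 - F m 𝒪` is nonnegative. [this work] -/
theorem coeff_one_sub_F_nonneg [Fintype A] (𝒪 : Finset (Finset A)) (h𝒪 : ∀ S ∈ 𝒪, ∀ S' ∈ 𝒪, S ∪ S' ∈ 𝒪)
    (hm : IsConfig m) (n : A →₀ ℕ) : 0 ≤ coeff n (1 - (F m hm 𝒪 : MvPowerSeries A ℚ)) :=
  coeff_one_sub_F_nonneg_aux 𝒪 h𝒪 n.degree n.degree 1 (by omega) m hm (fun C _ => vanLT_one_of_isConfig hm C) n le_rfl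

/-- **(PAR), configuration form.**  For a union-closed family `𝒪` of colour sets, every coefficient of
`1 - F_𝒪 = 1 - ∏_{S ∈ 𝒪} ∏_{B ⊆ S} (1 - x(B))^{(-1)^{#(S∖B)}}` is nonnegative. [this work] -/
theorem coeff_one_sub_F_m0_nonneg [Fintype A] (𝒪 : Finset (Finset A)) (h𝒪 : ∀ S ∈ 𝒪, ∀ S' ∈ 𝒪, S ∪ S' ∈ 𝒪)
    (n : A →₀ ℕ) : 0 ≤ coeff n (1 - (F (m0 A) isConfig_m0 𝒪 : MvPowerSeries A ℚ)) :=
  coeff_one_sub_F_nonneg 𝒪 h𝒪 isConfig_m0 n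

/-! ## The explicit statement -/

/-- The Möbius factor `t_S = ∏_{B ⊆ S} (1 - x(B))^{(-1)^{#(S∖B)}}` as an explicit power series:
(product over `B` with `#(S∖B)` even) · (product over `B` with `#(S∖B)` odd)⁻¹. [this work] -/
noncomputable def tS (S : Finset A) : MvPowerSeries A ℚ :=
  (∏ B ∈ S.powerset with Even (S \ B).card, (1 - ∑ a ∈ B, X a)) *
    (∏ B ∈ S.powerset with ¬ Even (S \ B).card, (1 - ∑ a ∈ B, X a))⁻¹

omit [DecidableEq A] in
/-- `(∏ φ_i)⁻¹ = ∏ φ_i⁻¹` for multivariate power series over a field. [this work] -/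
theorem prod_inv_eq {ι : Type*} (s : Finset ι) (f : ι → MvPowerSeries A ℚ) :
    (∏ i ∈ s, f i)⁻¹ = ∏ i ∈ s, (f i)⁻¹ := by
  classical
  induction s using Finset.induction_on with
  | empty => simp
  | insert i s hi ih => rw [prod_insert hi, prod_insert hi, MvPowerSeries.mul_inv_rev, ih, mul_comm]

/-- For the initial configuration the Möbius factor `T S` is the explicit series `tS S`. [this work] -/
theorem val_T_m0 (S : Finset A) : (T (m0 A) isConfig_m0 S : MvPowerSeries A ℚ) = tS S := by
  unfold T tS
  rw [← prod_filter_mul_prod_filter_not S.powerset (fun B => Even (S \ B).card), Units.val_mul, Units.coe_prod,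
    Units.coe_prod, prod_inv_eq]
  congr 1
  · refine prod_congr rfl fun B hB => ?_
    have he : Even (S \ B).card := (mem_filter.mp hB).2
    rw [sgn, he.neg_one_pow, zpow_one, val_U, y_m0]
  · refine prod_congr rfl fun B hB => ?_
    have ho : Odd (S \ B).card := Nat.not_even_iff_odd.mp (mem_filter.mp hB).2
    rw [sgn, ho.neg_one_pow, zpow_neg_one, U, val_inv_unitOf, y_m0]

/-- **(PAR)** (memo FINDING-PAR-prove1-g46 Theorem 1; g45 FINDING-MOBIUS §4e).  For every UNION-CLOSED family `𝒪`
of subsets of a finite set `A`, every coefficient of the power series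
    `1 - ∏_{S ∈ 𝒪} t_S`,   `t_S = ∏_{B ⊆ S} (1 - ∑_{a ∈ B} x_a)^{(-1)^{#(S∖B)}}`,
is nonnegative.  Equivalently (exponential formula, memo): for every word `w` over `A`, among the permutations of
its positions all of whose cycles have letter-sets in `𝒪`, those with an odd number of cycles are at least as
many as those with an even number.  This is the combinatorial kernel from which the memo derives the Möbius
certificate / balancedness of the cost game of every bipartite graph core (BAL-bip). [this work] -/
theorem coeff_one_sub_prod_tS_nonneg [Fintype A] (𝒪 : Finset (Finset A))
    (h𝒪 : ∀ S ∈ 𝒪, ∀ S' ∈ 𝒪, S ∪ S' ∈ 𝒪) (n : A →₀ ℕ) :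
    0 ≤ coeff n (1 - ∏ S ∈ 𝒪, tS S) := by
  have h := coeff_one_sub_F_m0_nonneg 𝒪 h𝒪 n
  rwa [F, Units.coe_prod, prod_congr rfl fun S _ => val_T_m0 S] at h

end OpenProduct

end Summit.CriticalPhenomena.PercolationContinuityZ3.Theorems.SunflowerPartition
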